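import Literature.Analysis.OperatorTheory.Enflo2023.CaseII
import HarnessLib

/-!
# Enflo 2023, v2 eq. (27): vacuity guard — the hypotheses of `CaseII.eq27_false_in_window` are satisfiable (explicit data in ℂ³)

Source under adjudication: Per H. Enflo, *On the invariant subspace problem in Hilbert spaces*, arXiv:2305.15442 (v1
2023, v2 2024), bib key `Enflo2023` — a CLAIMED proof of the invariant subspace problem for operators on a separable
Hilbert space.  This file is part of the kernel-tight typing of the manuscript by the b2b-enflo repair cell
(formaliser 1, Part A: v2 eq. (1)–(27), the set-up, the constructions `V_y`, `ℓ'`, `[ ]x₀`, Lemma 1 and Case I/II of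
the main step).  It records what FOLLOWS (proved implications from the manuscript's displayed hypotheses) and, where a
step does not follow, the typed inference together with its refutation.  NOTHING here asserts that the manuscript's
main theorem holds; no declaration concludes the invariant subspace problem for an arbitrary operator.  Value
(BLOCK-2b): theorems / refutations of typed inferences about a text — not progress on the problem.

VACUITY GUARD for `CaseII.eq27_false_in_window` (GAP.md §F1 item (2)).  That theorem refutes the inference
(25),(26) ⇒ (27) of v2 p.13 by deriving, from the facts the text has at that point, the OPPOSITE of (27) in the
paper's own window.  A refutation of this shape is only informative if its fourteen hypotheses are jointly
satisfiable; here they are realised explicitly in any complex inner-product space containing an orthonormal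
triple `e₀, e₁, e₂` (so in `ℂ³`):
  `x₀ = e₀`, `y = (4/5)e₀ + q e₁` with `q = 2/5 − 10⁻²⁴`, `εθ = (4/5)·10⁻²⁴ − 10⁻⁴⁸`
  (then `⟨x₀ − y, y⟩ = εθ` exactly and `‖x₀ − y‖² = 1/5 − εθ`),
  `w = α u + β e₂` with `u = q e₀ + (1/5)e₁ ⟂ x₀ − y`, `α = 4·10⁻²¹`, `β = 2·10⁻²¹`
  (`‖w‖² ≤ 10⁻⁴⁰`, `⟨x₀ − y, w⟩ = 0`, `⟨y, w⟩ = αq ≥ 10⁻²¹`, the component of `w` orthogonal to `y` has norm `≥ β`),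
  `a₀ = 1`, `a₁ = 0`, `t = 0`, `A = 0`, `C = εθ` (the KKT equations then read `⟨y, x₀ − y⟩ = εθ`, `⟨w, x₀ − y⟩ = 0`).
Results: `CaseII.WindowModel.hypotheses` (all fourteen hypotheses hold on this data),
`CaseII.WindowModel.eq27_false_fires` (the theorem applied to it), `CaseII.window_hypotheses_satisfiable`
(the existential statement in `EuclideanSpace ℂ (Fin 3)`).
Origin: planner-b2b-enflo-1-0, 2026-08-18.  Imports `Literature.Analysis.OperatorTheory.Enflo2023.CaseII` (Mathlib only otherwise).
-/

noncomputable section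

open scoped InnerProductSpace
open Literature.Analysis.UnboundedOperators (inner_self_eq_coe_norm_sq)
open scoped ComplexConjugate

namespace Literature.Analysis.OperatorTheory.Enflo2023

namespace CaseII

namespace WindowModel

/-- `η = 10⁻²⁴`, the offset that makes `εθ` land in the window. [cite: Enflo2023, v2 p.13, eq. (27)] -/
def eta : ℝ := 1 / 10 ^ 24
/-- `q = 2/5 − η`, second coordinate of `y`. [cite: Enflo2023, v2 p.13, eq. (27)] -/
def q : ℝ := 2 / 5 - eta
/-- `εθ = (4/5)η − η²`. [cite: Enflo2023, v2 p.13, eq. (27)] -/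
def et : ℝ := 4 / 5 * eta - eta ^ 2
/-- `α = 4·10⁻²¹`. [cite: Enflo2023, v2 p.13, eq. (27)] -/
def alpha : ℝ := 4 / 10 ^ 21
/-- `β = 2·10⁻²¹`. [cite: Enflo2023, v2 p.13, eq. (27)] -/
def beta : ℝ := 2 / 10 ^ 21

/-- `η = 10⁻²⁴` unfolded. [cite: Enflo2023, v2 p.13, eq. (27)] -/
lemma eta_def : eta = 1 / 10 ^ 24 := rfl
/-- `q = 2/5 − 10⁻²⁴` unfolded. [cite: Enflo2023, v2 p.13, eq. (27)] -/
lemma q_def : q = 2 / 5 - 1 / 10 ^ 24 := rfl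
/-- `εθ = (4/5)·10⁻²⁴ − 10⁻⁴⁸` unfolded. [cite: Enflo2023, v2 p.13, eq. (27)] -/
lemma et_def : et = 4 / 5 * (1 / 10 ^ 24) - (1 / 10 ^ 24) ^ 2 := rfl
/-- `α = 4·10⁻²¹` unfolded. [cite: Enflo2023, v2 p.13, eq. (27)] -/
lemma alpha_def : alpha = 4 / 10 ^ 21 := rfl
/-- `β = 2·10⁻²¹` unfolded. [cite: Enflo2023, v2 p.13, eq. (27)] -/
lemma beta_def : beta = 2 / 10 ^ 21 := rfl

variable {H : Type*} [NormedAddCommGroup H] [InnerProductSpace ℂ H]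
variable (e : Fin 3 → H)

/-- `x₀ = e₀`. [cite: Enflo2023, v2 p.13, eq. (27)] -/
def x0 : H := e 0
/-- `y = (4/5) e₀ + q e₁`. [cite: Enflo2023, v2 p.13, eq. (27)] -/
def y : H := ((4 / 5 : ℝ) : ℂ) • e 0 + ((q : ℝ) : ℂ) • e 1
/-- `u = q e₀ + (1/5) e₁`, orthogonal to `x₀ − y = (1/5) e₀ − q e₁`. [cite: Enflo2023, v2 p.13, eq. (27)] -/
def u : H := ((q : ℝ) : ℂ) • e 0 + ((1 / 5 : ℝ) : ℂ) • e 1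
/-- `w = α u + β e₂`. [cite: Enflo2023, v2 p.13, eq. (27)] -/
def w : H := ((alpha : ℝ) : ℂ) • u e + ((beta : ℝ) : ℂ) • e 2

variable {e}

section inner
variable (he : Orthonormal ℂ e)
include he

/-- Inner products of the orthonormal triple. [folklore] -/
lemma inner_e (i j : Fin 3) : ⟪e i, e j⟫_ℂ = if i = j then (1 : ℂ) else 0 :=
  orthonormal_iff_ite.1 he i j

/-- `⟪e₀, y⟫ = 4/5`. [cite: Enflo2023, v2 p.13, eq. (27)] -/
lemma inner_e0_y : ⟪e 0, y e⟫_ℂ = ((4 / 5 : ℝ) : ℂ) := by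
  simp [y, inner_e he, he.1]

/-- `⟪e₁, y⟫ = q`. [cite: Enflo2023, v2 p.13, eq. (27)] -/
lemma inner_e1_y : ⟪e 1, y e⟫_ℂ = ((q : ℝ) : ℂ) := by
  simp [y, inner_e he, he.1]

/-- `⟪e₂, y⟫ = 0`. [cite: Enflo2023, v2 p.13, eq. (27)] -/
lemma inner_e2_y : ⟪e 2, y e⟫_ℂ = 0 := by
  simp [y, inner_e he]

/-- `⟪y, y⟫ = (4/5)² + q²`. [cite: Enflo2023, v2 p.13, eq. (27)] -/
lemma inner_y_y : ⟪y e, y e⟫_ℂ = (((4 / 5) ^ 2 + q ^ 2 : ℝ) : ℂ) := by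
  simp only [y, inner_add_left, inner_add_right, inner_smul_left, inner_smul_right, inner_e he,
    Complex.conj_ofReal]
  simp; ring

/-- `⟪e₀, u⟫ = q`. [cite: Enflo2023, v2 p.13, eq. (27)] -/
lemma inner_e0_u : ⟪e 0, u e⟫_ℂ = ((q : ℝ) : ℂ) := by
  simp [u, inner_e he, he.1]

/-- `⟪e₁, u⟫ = 1/5`. [cite: Enflo2023, v2 p.13, eq. (27)] -/
lemma inner_e1_u : ⟪e 1, u e⟫_ℂ = ((1 / 5 : ℝ) : ℂ) := by
  simp [u, inner_e he, he.1]

/-- `⟪e₂, u⟫ = 0`. [cite: Enflo2023, v2 p.13, eq. (27)] -/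
lemma inner_e2_u : ⟪e 2, u e⟫_ℂ = 0 := by
  simp [u, inner_e he]

/-- `⟪y, u⟫ = (4/5)q + q/5 = q`. [cite: Enflo2023, v2 p.13, eq. (27)] -/
lemma inner_y_u : ⟪y e, u e⟫_ℂ = ((q : ℝ) : ℂ) := by
  simp only [y, inner_add_left, inner_smul_left, inner_e0_u he, inner_e1_u he, Complex.conj_ofReal]
  push_cast; ring

/-- `⟪u, u⟫ = q² + 1/25`. [cite: Enflo2023, v2 p.13, eq. (27)] -/
lemma inner_u_u : ⟪u e, u e⟫_ℂ = ((q ^ 2 + (1 / 5) ^ 2 : ℝ) : ℂ) := by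
  simp only [u, inner_add_left, inner_add_right, inner_smul_left, inner_smul_right, inner_e he,
    Complex.conj_ofReal]
  simp; ring

/-- `⟪e₀, w⟫ = αq`. [cite: Enflo2023, v2 p.13, eq. (27)] -/
lemma inner_e0_w : ⟪e 0, w e⟫_ℂ = ((alpha * q : ℝ) : ℂ) := by
  simp only [w, inner_add_right, inner_smul_right, inner_e0_u he, inner_e he]
  simp

/-- `⟪e₂, w⟫ = β`. [cite: Enflo2023, v2 p.13, eq. (27)] -/
lemma inner_e2_w : ⟪e 2, w e⟫_ℂ = ((beta : ℝ) : ℂ) := by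
  simp only [w, inner_add_right, inner_smul_right, inner_e2_u he, inner_e he]
  simp

/-- `⟪y, w⟫ = αq` (the `κ₁`-type quantity of Case II). [cite: Enflo2023, v2 p.13, eq. (27)] -/
lemma inner_y_w : ⟪y e, w e⟫_ℂ = ((alpha * q : ℝ) : ℂ) := by
  simp only [w, inner_add_right, inner_smul_right, inner_y_u he]
  rw [show ⟪y e, e 2⟫_ℂ = 0 by rw [← inner_conj_symm, inner_e2_y he, map_zero]]
  simp

/-- `⟪u, e₂⟫ = 0`. [cite: Enflo2023, v2 p.13, eq. (27)] -/
lemma inner_u_e2 : ⟪u e, e 2⟫_ℂ = 0 := by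
  rw [← inner_conj_symm, inner_e2_u he, map_zero]

/-- `⟪w, w⟫ = α²(q² + 1/25) + β²`. [cite: Enflo2023, v2 p.13, eq. (27)] -/
lemma inner_w_w : ⟪w e, w e⟫_ℂ = ((alpha ^ 2 * (q ^ 2 + (1 / 5) ^ 2) + beta ^ 2 : ℝ) : ℂ) := by
  simp only [w, inner_add_left, inner_add_right, inner_smul_left, inner_smul_right, inner_u_u he,
    inner_u_e2 he, inner_e2_u he, inner_e he, Complex.conj_ofReal]
  simp; ring

/-- `⟪x₀ − y, y⟫ = 4/25 − q² = εθ` — the defining relation (8) holds exactly on the model. [cite: Enflo2023, v2 p.13, eq. (27)] -/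
lemma inner_x0y_y : ⟪x0 e - y e, y e⟫_ℂ = ((et : ℝ) : ℂ) := by
  rw [inner_sub_left, x0, inner_e0_y he, inner_y_y he, q, et]
  push_cast; ring

/-- `⟪x₀ − y, w⟫ = αq − αq = 0`: Case II (`|⟨x₀ − y, w⟩| ≤ (εθ)⁴`) holds with room to spare. [cite: Enflo2023, v2 p.13, eq. (27)] -/
lemma inner_x0y_w : ⟪x0 e - y e, w e⟫_ℂ = 0 := by
  rw [inner_sub_left, x0, inner_e0_w he, inner_y_w he, sub_self]

/-- `‖x₀ − y‖² = 1 − 8/5 + (16/25 + q²) = 1/5 − εθ` as an inner product. [cite: Enflo2023, v2 p.13, eq. (27)] -/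
lemma inner_x0y_self : ⟪x0 e - y e, x0 e - y e⟫_ℂ = ((1 / 5 - et : ℝ) : ℂ) := by
  rw [inner_sub_right, inner_sub_left, inner_sub_left, x0, inner_e he, inner_e0_y he,
    ← inner_conj_symm (y e) (e 0), inner_e0_y he, inner_y_y he, Complex.conj_ofReal, q, et]
  simp; ring

omit he in
/-- `‖v‖² = r` from `⟪v, v⟫ = r`. [folklore] -/
lemma norm_sq_of_inner (v : H) (r : ℝ) (h : ⟪v, v⟫_ℂ = (r : ℂ)) : ‖v‖ ^ 2 = r := by
  rw [inner_self_eq_coe_norm_sq] at h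
  exact_mod_cast h

/-- `‖x₀‖ = 1`. [cite: Enflo2023, v2 p.13, eq. (27)] -/
lemma norm_x0 : ‖x0 e‖ = 1 := he.1 0

/-- `‖x₀ − y‖² = 1/5 − εθ` (so `‖x₀ − y‖ ≈ 0.447 ∈ [0.3, 0.7]`). [cite: Enflo2023, v2 p.13, eq. (27)] -/
lemma norm_sq_x0y : ‖x0 e - y e‖ ^ 2 = 1 / 5 - et := norm_sq_of_inner _ _ (inner_x0y_self he)

/-- `‖w‖² = α²(q² + 1/25) + β² ≤ 10⁻⁴⁰`. [cite: Enflo2023, v2 p.13, eq. (27)] -/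
lemma norm_sq_w : ‖w e‖ ^ 2 = alpha ^ 2 * (q ^ 2 + (1 / 5) ^ 2) + beta ^ 2 :=
  norm_sq_of_inner _ _ (inner_w_w he)

/-- The component of `w` orthogonal to `y` has norm at least `β` (its `e₂`-coordinate is `β`). [cite: Enflo2023, v2 p.13, eq. (27)] -/
lemma beta_le_norm_orth : beta ≤ ‖w e - (⟪y e, w e⟫_ℂ / ((‖y e‖ ^ 2 : ℝ) : ℂ)) • y e‖ := by
  set v := w e - (⟪y e, w e⟫_ℂ / ((‖y e‖ ^ 2 : ℝ) : ℂ)) • y e with hv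
  have h1 : ⟪e 2, v⟫_ℂ = ((beta : ℝ) : ℂ) := by
    rw [hv, inner_sub_right, inner_smul_right, inner_e2_w he, inner_e2_y he, mul_zero, sub_zero]
  have h2 : ‖⟪e 2, v⟫_ℂ‖ ≤ ‖e 2‖ * ‖v‖ := norm_inner_le_norm (𝕜 := ℂ) (e 2) v
  rw [h1, he.1 2, one_mul, Complex.norm_real, Real.norm_of_nonneg (by rw [beta_def]; positivity)] at h2
  exact h2

/-- ALL FOURTEEN HYPOTHESES of `CaseII.eq27_false_in_window` hold on the model data
(`t = 0`, `a₀ = 1`, `a₁ = 0`, `C = εθ`, `A = 0`). [cite: Enflo2023, v2 p.13, eq. (27)] -/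
theorem hypotheses :
    ‖x0 e‖ = 1 ∧
    ⟪x0 e - y e, y e⟫_ℂ = ((et : ℝ) : ℂ) ∧
    (1 / 10 ^ 35 ≤ et ∧ et ≤ 1 / 10 ^ 23) ∧
    ((0.3 : ℝ) ≤ ‖x0 e - y e‖ ∧ ‖x0 e - y e‖ ≤ 0.7) ∧
    ‖w e‖ ≤ 1 / 10 ^ 20 ∧
    ‖⟪x0 e - y e, w e⟫_ℂ‖ ≤ et ^ 4 ∧
    1 / 10 ^ 21 ≤ ‖⟪y e, w e⟫_ℂ‖ ∧
    1 / 10 ^ 21 ≤ ‖w e - (⟪y e, w e⟫_ℂ / ((‖y e‖ ^ 2 : ℝ) : ℂ)) • y e‖ ∧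
    ‖(0 : ℂ)‖ ≤ (0 : ℝ) ∧
    ‖(1 : ℂ)‖ ^ 2 + (0 : ℝ) ^ 2 ≤ (1 + et / 10) ^ 2 ∧
    ‖(0 : H)‖ ≤ (0 : ℝ) / 10 ^ 40 ∧
    ⟪y e, x0 e - ((1 : ℂ) • y e + (0 : ℂ) • w e + 0)⟫_ℂ = ((et : ℝ) : ℂ) * 1 ∧
    ⟪w e, x0 e - ((1 : ℂ) • y e + (0 : ℂ) • w e + 0)⟫_ℂ = ((et : ℝ) : ℂ) * 0 := by
  have het : 1 / 10 ^ 35 ≤ et ∧ et ≤ 1 / 10 ^ 23 := by rw [et_def]; constructor <;> norm_num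
  have het0 : 0 ≤ et := le_trans (by norm_num) het.1
  have hn2 := norm_sq_x0y he
  have hw2 := norm_sq_w he
  have hsimp : (1 : ℂ) • y e + (0 : ℂ) • w e + 0 = y e := by simp
  refine ⟨norm_x0 he, inner_x0y_y he, het, ⟨?_, ?_⟩, ?_, ?_, ?_, ?_, by simp, ?_, by simp, ?_, ?_⟩
  · nlinarith [norm_nonneg (x0 e - y e), het.2]
  · nlinarith [norm_nonneg (x0 e - y e), het.1]
  · have hw2' : ‖w e‖ ^ 2 ≤ (1 / 10 ^ 20) ^ 2 := by rw [hw2, alpha_def, beta_def, q_def]; norm_num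
    exact (pow_le_pow_iff_left₀ (norm_nonneg _) (by norm_num) two_ne_zero).1 hw2'
  · rw [inner_x0y_w he, norm_zero]; positivity
  · rw [inner_y_w he, Complex.norm_real, Real.norm_of_nonneg (by rw [alpha_def, q_def]; norm_num),
      alpha_def, q_def]; norm_num
  · exact le_trans (by rw [beta_def]; norm_num) (beta_le_norm_orth he)
  · simp only [norm_one, one_pow]; nlinarith [het0]
  · rw [hsimp, mul_one, ← inner_conj_symm, inner_x0y_y he, Complex.conj_ofReal]
  · rw [hsimp, mul_zero, ← inner_conj_symm, inner_x0y_w he, map_zero]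

/-- The refutation theorem FIRES on the model: its conclusion, obtained by applying
`CaseII.eq27_false_in_window` to the data above (so that theorem is not vacuously true). [cite: Enflo2023, v2 p.13, eq. (27)] -/
theorem eq27_false_fires [CompleteSpace H] :
    et ^ 2 ≤ ‖((1 : ℂ) • y e + (0 : ℂ) • w e + 0) - ((1 + et / 10 : ℝ) : ℂ) • y e‖ := by
  obtain ⟨h0, hey, ⟨het1, het2⟩, ⟨hρ1, hρ2⟩, hw, hcase, hκ, hτ, hn1A, hbudget, ht, hk0, hk1⟩ :=
    hypotheses he
  exact eq27_false_in_window (x0 e) (y e) (w e) 0 1 0 ((et : ℝ) : ℂ) 0 et h0 hey het1 het2 hρ1 hρ2 hw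
    hcase hκ hτ hn1A hbudget ht hk0 hk1

end inner

end WindowModel

/-- The hypothesis set of `CaseII.eq27_false_in_window` is satisfiable in `ℂ³`
(`EuclideanSpace ℂ (Fin 3)` with its standard basis): the window refutation of (27) is not vacuous. [cite: Enflo2023, v2 p.13, eq. (27)] -/
theorem window_hypotheses_satisfiable :
    ∃ (x₀ y w t : EuclideanSpace ℂ (Fin 3)) (a₀ a₁ C : ℂ) (A et : ℝ),
      ‖x₀‖ = 1 ∧ ⟪x₀ - y, y⟫_ℂ = (et : ℂ) ∧ (1 / 10 ^ 35 ≤ et ∧ et ≤ 1 / 10 ^ 23) ∧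
      ((0.3 : ℝ) ≤ ‖x₀ - y‖ ∧ ‖x₀ - y‖ ≤ 0.7) ∧ ‖w‖ ≤ 1 / 10 ^ 20 ∧
      ‖⟪x₀ - y, w⟫_ℂ‖ ≤ et ^ 4 ∧ 1 / 10 ^ 21 ≤ ‖⟪y, w⟫_ℂ‖ ∧
      1 / 10 ^ 21 ≤ ‖w - (⟪y, w⟫_ℂ / ((‖y‖ ^ 2 : ℝ) : ℂ)) • y‖ ∧
      ‖a₁‖ ≤ A ∧ ‖a₀‖ ^ 2 + A ^ 2 ≤ (1 + et / 10) ^ 2 ∧ ‖t‖ ≤ A / 10 ^ 40 ∧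
      ⟪y, x₀ - (a₀ • y + a₁ • w + t)⟫_ℂ = C * a₀ ∧
      ⟪w, x₀ - (a₀ • y + a₁ • w + t)⟫_ℂ = C * a₁ := by
  let e : Fin 3 → EuclideanSpace ℂ (Fin 3) := fun i => EuclideanSpace.basisFun (Fin 3) ℂ i
  have he : Orthonormal ℂ e := (EuclideanSpace.basisFun (Fin 3) ℂ).orthonormal
  exact ⟨WindowModel.x0 e, WindowModel.y e, WindowModel.w e, 0, 1, 0, ((WindowModel.et : ℝ) : ℂ), 0,
    WindowModel.et, WindowModel.hypotheses he⟩

end CaseII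

end Literature.Analysis.OperatorTheory.Enflo2023

end
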